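import Summits.QuantumFields.YangMills.Theorems.BalabanUVNodesN19AdditiveLinksMomentLadder
import Summits.QuantumFields.YangMills.Theorems.BalabanUVNodesN19LipschitzLinksMomentFirstOrder

/-!
# YM-DAG node N19 (= NE7 proper) — THE SMOOTHED-LINK FIRST-ORDER LAW WITH MASS, GENERAL ADDITIVE LIPSCHITZ STATISTIC `T = Σ_iφ_i(x_i)`
# (module 155 with `Σ|x_i|` replaced by `Σφ_i(x_i)`, `φ_i : [−1,1] → [0,1]` `1`-Lipschitz)

Cell `pub-ymgap`, HUMAN RULING D-0062 (Track A) ∕ D-0149 (work-bound push), R141 (C) wider-strategy seat `pub-ymgap-dag-n19-e` (strategy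
s3 = ALTERNATIVE CURRENCY), generation g33, module 15 (lineage module 162).  Route `Summits/QuantumFields/YangMills/Theses/BalabanUVNodes.lean`,
cluster item K3⁸ «SpineGivenEndpointR13SepCoPHV» (stmt-QuantumFields-27366); filed `--supports` that item `--as helper` (it proves no registered
stub).  COUNT-NEUTRAL: [folklore]∕[bookkeeping] over the lineage BY NAME — module 161 (`exists_ladder_pairs_near_cexp_additive_mass_uniform`,
`exists_additiveJackson_mass_of_lipschitz`), module 155 (`massExponent_mono`), module 127 (mass algebra), module 151 (real faces of a pair); no laws,
no scheme object, no Theses import; NOT a discharge claim.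

CONTENT.  ★★★ `exists_mvPolynomial_near_trigLink_additive_firstOrder_mass`: for `1`-Lipschitz `φ_i : [−1,1] → [0,1]`, a trigonometric link `g`
(`0 ≤ ω_p ≤ Ω`, mass `≤ W`, `C^{1,1}` constant `B₂`, `|g′| ≤ B₁`), `J`, `h ≥ 1`, `N ≥ 2^J`, `(J+1)e^{−h} ≤ ½`: a real `MvPolynomial` `P` with
`mass P ≤ W·exp Λ(Ωd)·(1 + 2Ωd·N·9^N)` and `|(g(Σ_iφ_i(x_i)) − c) − P(x)| ≤ B₂(dπ∕2^J)² + B₁dπ∕N + 2(J+1)e^{−h}W(1 + Ω(dπ∕2^J + dπ∕N))` on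
`[−1,1]^ι` — module 155's proof verbatim.  The sequel (`…N19AdditiveLinksMomentBudget`) prices it with module 156's parameters BY NAME.

HONEST FRAMING (binding).  Elementary and [folklore]; NO consumer in the DAG today (the seat's own currency map); nothing of Bałaban's instantiated; NE7
NOT PRINTED, NOT proved; N19 NOT discharged; count-neutral.  One finite `T⁴` programme at fixed `ε`; nothing continuum ∕ `ℝ⁴` ∕ OS ∕ mass-gap ∕ Clay.
0 `def` ∕ 0 `sorry`.
-/

noncomputable section

open Finset Complex
open scoped Real

namespace Summit.QuantumFields.YangMills.Theorems.BalabanUVNodesN19AdditiveLinksMomentFirstOrder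

open Summit.QuantumFields.YangMills.Theorems.BalabanUVNodesN19AdditiveLinksMomentLadder
  (exists_ladder_pairs_near_cexp_additive_mass_uniform exists_additiveJackson_mass_of_lipschitz)
open Summit.QuantumFields.YangMills.Theorems.BalabanUVNodesN19LipschitzLinksMomentFirstOrder (massExponent_mono)
open Summit.QuantumFields.YangMills.Theorems.BalabanUVNodesN19CoefficientMassPricing
open Summit.QuantumFields.YangMills.Theorems.BalabanUVNodesN19SmoothLinkFirstOrder (abs_cos_sub_le_of_pair abs_sin_sub_le_of_pair)

variable {ι : Type*} [Fintype ι]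
variable {φ : ι → ℝ → ℝ}
  (hφL : ∀ i, ∀ u v : ℝ, u ∈ Set.Icc (-1 : ℝ) 1 → v ∈ Set.Icc (-1 : ℝ) 1 → |φ i u - φ i v| ≤ 1 * |u - v|)
  (hφ0 : ∀ i, ∀ u : ℝ, u ∈ Set.Icc (-1 : ℝ) 1 → 0 ≤ φ i u) (hφ1 : ∀ i, ∀ u : ℝ, u ∈ Set.Icc (-1 : ℝ) 1 → φ i u ≤ 1)

/-! ## §1 ★★★ The law with mass, general additive statistic [folklore] -/

include hφL hφ0 hφ1 in
/-- ★★★ **THE SMOOTHED-LINK FIRST-ORDER LAW WITH COEFFICIENT MASS, GENERAL ADDITIVE STATISTIC** (module 155 verbatim with `Σ|x_i| ↦ Σφ_i(x_i)` and module 161's ladder∕approximants).   Let `g(s) = c + Σ_{p∈σ}(α_p cos(ω_p s) + β_p sin(ω_p s))` with `0 ≤ ω_p ≤ Ω`,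
`Σ_p(|α_p| + |β_p|) ≤ W`, derivative `g₁`, `|g(u) − g(a) − g₁(a)(u − a)| ≤ B₂(u − a)²`, `|g₁| ≤ B₁`; let `J`, `h ≥ 1`, `N ≥ 2^J` with
`(J+1)e^{−h} ≤ ½`.  Then there is a real `MvPolynomial` `P` with `mass P ≤ W·exp Λ(Ωd)·(1 + 2Ωd·N·9^N)` (`d = |ι|`, `Λ` as in module 154) and
`|(g(Σ_i|x_i|) − c) − P(x)| ≤ B₂(dπ∕2^J)² + B₁dπ∕N + 2(J+1)e^{−h}·W·(1 + Ω(dπ∕2^J + dπ∕N))` on `[−1,1]^ι` — module 151's polynomial minus its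
constant, with module 154's pairs; the mass is the sum over the modes of `(|α_p| + |β_p|)·exp Λ(ω_pd)` (`Λ` monotone in the frequency) plus the
product with `mass(A_N − A_J) ≤ 2dN9^N`. [folklore] -/
theorem exists_mvPolynomial_near_trigLink_additive_firstOrder_mass {σ : Type*} (P₀ : Finset σ) (c : ℝ) (α β ω : σ → ℝ)
    {g g₁ : ℝ → ℝ} {Ω W B₁ B₂ : ℝ}
    (hg : ∀ s, g s = c + ∑ p ∈ P₀, (α p * Real.cos (ω p * s) + β p * Real.sin (ω p * s)))
    (hg₁ : ∀ s, g₁ s = ∑ p ∈ P₀, ω p * (β p * Real.cos (ω p * s) - α p * Real.sin (ω p * s)))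
    (hΩ : 0 ≤ Ω) (hω0 : ∀ p, 0 ≤ ω p) (hωΩ : ∀ p ∈ P₀, ω p ≤ Ω) (hW : ∑ p ∈ P₀, (|α p| + |β p|) ≤ W)
    (hC11 : ∀ u a, |g u - g a - g₁ a * (u - a)| ≤ B₂ * (u - a) ^ 2) (hB₁ : ∀ a, |g₁ a| ≤ B₁)
    (J h N : ℕ) (hh : 1 ≤ h) (hJh : ((J : ℝ) + 1) * Real.exp (-(h : ℝ)) ≤ 1 / 2) (hN : 2 ^ J ≤ N) :
    ∃ P : MvPolynomial ι ℝ,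
      (∑ s ∈ P.support, |P.coeff s|) ≤ W * Real.exp (((J : ℝ) + 1) * Real.log 2 +
          (6 * π * Real.exp 2 * (Ω * Fintype.card ι) + h * ((J : ℝ) + 1)) * Real.log (1 + 10 * (Ω * Fintype.card ι)) +
          (3 * π * Real.exp 2 * (Ω * Fintype.card ι) * ((J : ℝ) + 1) + h * (2 ^ (J + 1) - 1)) * Real.log 81) *
        (1 + 2 * (Ω * Fintype.card ι) * (N * 9 ^ N)) ∧
      ∀ x : ι → ℝ, (∀ i, x i ∈ Set.Icc (-1 : ℝ) 1) →
        |(g (∑ i, φ i (x i)) - c) - MvPolynomial.eval x P| ≤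
          B₂ * (Fintype.card ι * π / 2 ^ J) ^ 2 + B₁ * (Fintype.card ι * π / N) +
            2 * ((J : ℝ) + 1) * Real.exp (-(h : ℝ)) * W *
              (1 + Ω * (Fintype.card ι * π / 2 ^ J + Fintype.card ι * π / N)) := by
  classical
  set d : ℝ := (Fintype.card ι : ℝ) with hd
  have hd0 : 0 ≤ d := Nat.cast_nonneg _
  have hNpos : 0 < N := lt_of_lt_of_le (pow_pos two_pos J) hN
  have hNr : (0 : ℝ) < N := by exact_mod_cast hNpos
  have h2J : (0 : ℝ) < 2 ^ J := by positivity
  set ε : ℝ := 2 * ((J : ℝ) + 1) * Real.exp (-(h : ℝ)) with hε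
  have hε0 : 0 ≤ ε := by positivity
  -- sign facts from the hypotheses
  have hW0 : 0 ≤ W := le_trans (Finset.sum_nonneg fun p _ => by positivity) hW
  have hB₁0 : 0 ≤ B₁ := (abs_nonneg _).trans (hB₁ 0)
  have hB₂0 : 0 ≤ B₂ := by
    have h1 := hC11 1 0
    have : (0 : ℝ) ≤ B₂ * (1 - 0) ^ 2 := (abs_nonneg _).trans h1
    simpa using this
  -- the ladder (one `A_J`), its pairs, and the fine Jackson approximant `A_N`
  obtain ⟨A, hAmass, hAerr, hlad⟩ := exists_ladder_pairs_near_cexp_additive_mass_uniform hφL hφ0 hφ1 J h hh hJh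
  choose Cr Ci hCr hCi happ using fun p : σ => hlad (ω p) (hω0 p)
  obtain ⟨AN, hANmass, hANerr⟩ := exists_additiveJackson_mass_of_lipschitz hφL hφ0 hφ1 (M := N) hNpos
  -- masses: the exponent at the top frequency
  obtain ⟨E, hE⟩ : ∃ E : ℝ, E = Real.exp (((J : ℝ) + 1) * Real.log 2 +
      (6 * π * Real.exp 2 * (Ω * d) + h * ((J : ℝ) + 1)) * Real.log (1 + 10 * (Ω * d)) +
      (3 * π * Real.exp 2 * (Ω * d) * ((J : ℝ) + 1) + h * (2 ^ (J + 1) - 1)) * Real.log 81) := ⟨_, rfl⟩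
  have hE0 : 0 ≤ E := by rw [hE]; exact (Real.exp_pos _).le
  have hmono : ∀ p ∈ P₀, Real.exp (((J : ℝ) + 1) * Real.log 2 +
      (6 * π * Real.exp 2 * (ω p * d) + h * ((J : ℝ) + 1)) * Real.log (1 + 10 * (ω p * d)) +
      (3 * π * Real.exp 2 * (ω p * d) * ((J : ℝ) + 1) + h * (2 ^ (J + 1) - 1)) * Real.log 81) ≤ E := by
    intro p hp
    rw [hE]
    exact Real.exp_le_exp.2 (massExponent_mono J h (mul_nonneg (hω0 p) hd0) (mul_le_mul_of_nonneg_right (hωΩ p hp) hd0))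
  have hmCr : ∀ p ∈ P₀, (∑ s ∈ (Cr p).support, |(Cr p).coeff s|) ≤ E := fun p hp => (hCr p).trans (by rw [← hd]; exact hmono p hp)
  have hmCi : ∀ p ∈ P₀, (∑ s ∈ (Ci p).support, |(Ci p).coeff s|) ≤ E := fun p hp => (hCi p).trans (by rw [← hd]; exact hmono p hp)
  have hmassCmul : ∀ (r : ℝ) (Q : MvPolynomial ι ℝ), (∑ s ∈ Q.support, |Q.coeff s|) ≤ E →
      (∑ s ∈ (MvPolynomial.C r * Q).support, |(MvPolynomial.C r * Q).coeff s|) ≤ |r| * E := by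
    intro r Q hQ
    exact (mass_mul_le _ _).trans (mul_le_mul (mass_C_le _) hQ (Finset.sum_nonneg fun s _ => abs_nonneg _) (abs_nonneg _))
  -- the polynomial
  obtain ⟨G₀, hG₀⟩ : ∃ G₀ : MvPolynomial ι ℝ, G₀ = ∑ p ∈ P₀, (MvPolynomial.C (α p) * Cr p + MvPolynomial.C (β p) * Ci p) :=
    ⟨_, rfl⟩
  obtain ⟨G₁, hG₁⟩ : ∃ G₁ : MvPolynomial ι ℝ,
      G₁ = ∑ p ∈ P₀, MvPolynomial.C (ω p) * (MvPolynomial.C (β p) * Cr p - MvPolynomial.C (α p) * Ci p) := ⟨_, rfl⟩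
  have hG₀mass : (∑ s ∈ G₀.support, |G₀.coeff s|) ≤ W * E := by
    have hterm : ∀ p ∈ P₀, (∑ s ∈ (MvPolynomial.C (α p) * Cr p + MvPolynomial.C (β p) * Ci p).support,
        |(MvPolynomial.C (α p) * Cr p + MvPolynomial.C (β p) * Ci p).coeff s|) ≤ (|α p| + |β p|) * E := by
      intro p hp
      have h1 := hmassCmul (α p) (Cr p) (hmCr p hp)
      have h2 := hmassCmul (β p) (Ci p) (hmCi p hp)
      have h3 := mass_add_le (MvPolynomial.C (α p) * Cr p) (MvPolynomial.C (β p) * Ci p)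
      linarith
    rw [hG₀]
    refine (mass_sum_le P₀ (fun p => MvPolynomial.C (α p) * Cr p + MvPolynomial.C (β p) * Ci p)).trans ?_
    refine (Finset.sum_le_sum hterm).trans ?_
    rw [← Finset.sum_mul]
    exact mul_le_mul_of_nonneg_right hW hE0
  have hG₁mass : (∑ s ∈ G₁.support, |G₁.coeff s|) ≤ Ω * W * E := by
    have hterm : ∀ p ∈ P₀, (∑ s ∈ (MvPolynomial.C (ω p) * (MvPolynomial.C (β p) * Cr p - MvPolynomial.C (α p) * Ci p)).support,
        |(MvPolynomial.C (ω p) * (MvPolynomial.C (β p) * Cr p - MvPolynomial.C (α p) * Ci p)).coeff s|) ≤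
        Ω * ((|α p| + |β p|) * E) := by
      intro p hp
      have h1 := hmassCmul (β p) (Cr p) (hmCr p hp)
      have h2 := hmassCmul (α p) (Ci p) (hmCi p hp)
      have h3 := mass_sub_le (MvPolynomial.C (β p) * Cr p) (MvPolynomial.C (α p) * Ci p)
      have h4 : (∑ s ∈ (MvPolynomial.C (β p) * Cr p - MvPolynomial.C (α p) * Ci p).support,
          |(MvPolynomial.C (β p) * Cr p - MvPolynomial.C (α p) * Ci p).coeff s|) ≤ (|α p| + |β p|) * E := by linarith
      have h5 := mass_mul_le (MvPolynomial.C (ω p)) (MvPolynomial.C (β p) * Cr p - MvPolynomial.C (α p) * Ci p)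
      have h6 := mass_C_le (ι := ι) (ω p)
      rw [abs_of_nonneg (hω0 p)] at h6
      have h7 : (∑ s ∈ (MvPolynomial.C (ω p) : MvPolynomial ι ℝ).support, |(MvPolynomial.C (ω p) : MvPolynomial ι ℝ).coeff s|) *
          (∑ s ∈ (MvPolynomial.C (β p) * Cr p - MvPolynomial.C (α p) * Ci p).support,
            |(MvPolynomial.C (β p) * Cr p - MvPolynomial.C (α p) * Ci p).coeff s|) ≤ Ω * ((|α p| + |β p|) * E) :=
        mul_le_mul (h6.trans (hωΩ p hp)) h4 (Finset.sum_nonneg fun s _ => abs_nonneg _) hΩ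
      exact h5.trans h7
    rw [hG₁]
    refine (mass_sum_le P₀ (fun p => MvPolynomial.C (ω p) * (MvPolynomial.C (β p) * Cr p - MvPolynomial.C (α p) * Ci p))).trans ?_
    refine (Finset.sum_le_sum hterm).trans ?_
    rw [← Finset.mul_sum, ← Finset.sum_mul]
    calc Ω * ((∑ p ∈ P₀, (|α p| + |β p|)) * E) ≤ Ω * (W * E) := mul_le_mul_of_nonneg_left (mul_le_mul_of_nonneg_right hW hE0) hΩ
      _ = Ω * W * E := by ring
  have hΔmass : (∑ s ∈ (AN - A).support, |(AN - A).coeff s|) ≤ 2 * d * (N * 9 ^ N) := by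
    refine (mass_sub_le _ _).trans ?_
    rw [← hd] at hANmass hAmass
    have hmono' : (2 : ℝ) ^ J * 9 ^ (2 ^ J) ≤ N * 9 ^ N := by
      have h1 : ((2 ^ J : ℕ) : ℝ) ≤ N := by exact_mod_cast hN
      push_cast at h1
      exact mul_le_mul h1 (pow_le_pow_right₀ (by norm_num) hN) (by positivity) hNr.le
    have := mul_le_mul_of_nonneg_left hmono' hd0
    linarith
  refine ⟨G₀ + G₁ * (AN - A), ?_, fun x hx => ?_⟩
  · have hprod : (∑ s ∈ (G₁ * (AN - A)).support, |(G₁ * (AN - A)).coeff s|) ≤ (Ω * W * E) * (2 * d * (N * 9 ^ N)) :=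
      (mass_mul_le G₁ (AN - A)).trans (mul_le_mul hG₁mass hΔmass (Finset.sum_nonneg fun s _ => abs_nonneg _) (by positivity))
    calc _ ≤ _ := mass_add_le G₀ (G₁ * (AN - A))
      _ ≤ W * E + (Ω * W * E) * (2 * d * (N * 9 ^ N)) := add_le_add hG₀mass hprod
      _ = W * E * (1 + 2 * (Ω * d) * (N * 9 ^ N)) := by ring
      _ = _ := by rw [hE, hd]
  -- the error at `x`
  set s : ℝ := ∑ i, φ i (x i) with hs
  set a : ℝ := MvPolynomial.eval x A with ha
  set aN : ℝ := MvPolynomial.eval x AN with haN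
  have hsa : |s - a| ≤ d * π / 2 ^ J := hAerr x hx
  have hsaN : |s - aN| ≤ d * π / N := (hANerr x hx).trans_eq (by rw [hd]; ring)
  have haNa : |aN - a| ≤ d * π / 2 ^ J + d * π / N := by
    calc |aN - a| = |(s - a) - (s - aN)| := by ring_nf
      _ ≤ |s - a| + |s - aN| := abs_sub _ _
      _ ≤ d * π / 2 ^ J + d * π / N := add_le_add hsa hsaN
  -- evaluations of `G₀`, `G₁`
  have hevG₀ : MvPolynomial.eval x G₀ = ∑ p ∈ P₀, (α p * MvPolynomial.eval x (Cr p) + β p * MvPolynomial.eval x (Ci p)) := by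
    rw [hG₀, map_sum]
    refine Finset.sum_congr rfl fun p _ => ?_
    rw [map_add, map_mul, map_mul, MvPolynomial.eval_C, MvPolynomial.eval_C]
  have hevG₁ : MvPolynomial.eval x G₁ =
      ∑ p ∈ P₀, ω p * (β p * MvPolynomial.eval x (Cr p) - α p * MvPolynomial.eval x (Ci p)) := by
    rw [hG₁, map_sum]
    refine Finset.sum_congr rfl fun p _ => ?_
    rw [map_mul, MvPolynomial.eval_C, map_sub, map_mul, map_mul, MvPolynomial.eval_C, MvPolynomial.eval_C]
  -- the ladder errors at `a`
  have hcos : ∀ p, |Real.cos (ω p * a) - MvPolynomial.eval x (Cr p)| ≤ ε := fun p =>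
    abs_cos_sub_le_of_pair (happ p x hx)
  have hsin : ∀ p, |Real.sin (ω p * a) - MvPolynomial.eval x (Ci p)| ≤ ε := fun p =>
    abs_sin_sub_le_of_pair (happ p x hx)
  have hE₀ : |(g a - c) - MvPolynomial.eval x G₀| ≤ ε * W := by
    rw [hg a, add_sub_cancel_left, hevG₀, ← Finset.sum_sub_distrib]
    calc |∑ p ∈ P₀, (α p * Real.cos (ω p * a) + β p * Real.sin (ω p * a) -
            (α p * MvPolynomial.eval x (Cr p) + β p * MvPolynomial.eval x (Ci p)))|
        ≤ ∑ p ∈ P₀, |α p * Real.cos (ω p * a) + β p * Real.sin (ω p * a) -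
            (α p * MvPolynomial.eval x (Cr p) + β p * MvPolynomial.eval x (Ci p))| := abs_sum_le_sum_abs _ _
      _ ≤ ∑ p ∈ P₀, (|α p| + |β p|) * ε := by
          refine Finset.sum_le_sum fun p _ => ?_
          have e : α p * Real.cos (ω p * a) + β p * Real.sin (ω p * a) -
              (α p * MvPolynomial.eval x (Cr p) + β p * MvPolynomial.eval x (Ci p)) =
              α p * (Real.cos (ω p * a) - MvPolynomial.eval x (Cr p)) + β p * (Real.sin (ω p * a) - MvPolynomial.eval x (Ci p)) := by
            ring
          rw [e]
          calc |α p * (Real.cos (ω p * a) - MvPolynomial.eval x (Cr p)) + β p * (Real.sin (ω p * a) - MvPolynomial.eval x (Ci p))|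
              ≤ |α p * (Real.cos (ω p * a) - MvPolynomial.eval x (Cr p))| + |β p * (Real.sin (ω p * a) - MvPolynomial.eval x (Ci p))| :=
                abs_add_le _ _
            _ ≤ |α p| * ε + |β p| * ε := by
                rw [abs_mul, abs_mul]
                exact add_le_add (mul_le_mul_of_nonneg_left (hcos p) (abs_nonneg _))
                  (mul_le_mul_of_nonneg_left (hsin p) (abs_nonneg _))
            _ = (|α p| + |β p|) * ε := by ring
      _ = (∑ p ∈ P₀, (|α p| + |β p|)) * ε := by rw [Finset.sum_mul]
      _ ≤ W * ε := mul_le_mul_of_nonneg_right hW hε0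
      _ = ε * W := mul_comm _ _
  have hE₁ : |g₁ a - MvPolynomial.eval x G₁| ≤ ε * W * Ω := by
    rw [hg₁ a, hevG₁, ← Finset.sum_sub_distrib]
    calc |∑ p ∈ P₀, (ω p * (β p * Real.cos (ω p * a) - α p * Real.sin (ω p * a)) -
            ω p * (β p * MvPolynomial.eval x (Cr p) - α p * MvPolynomial.eval x (Ci p)))|
        ≤ ∑ p ∈ P₀, |ω p * (β p * Real.cos (ω p * a) - α p * Real.sin (ω p * a)) -
            ω p * (β p * MvPolynomial.eval x (Cr p) - α p * MvPolynomial.eval x (Ci p))| := abs_sum_le_sum_abs _ _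
      _ ≤ ∑ p ∈ P₀, (|α p| + |β p|) * ε * Ω := by
          refine Finset.sum_le_sum fun p hp => ?_
          have e : ω p * (β p * Real.cos (ω p * a) - α p * Real.sin (ω p * a)) -
              ω p * (β p * MvPolynomial.eval x (Cr p) - α p * MvPolynomial.eval x (Ci p)) =
              ω p * (β p * (Real.cos (ω p * a) - MvPolynomial.eval x (Cr p)) - α p * (Real.sin (ω p * a) - MvPolynomial.eval x (Ci p))) := by
            ring
          rw [e, abs_mul, abs_of_nonneg (hω0 p)]
          have h1 : |β p * (Real.cos (ω p * a) - MvPolynomial.eval x (Cr p)) - α p * (Real.sin (ω p * a) - MvPolynomial.eval x (Ci p))| ≤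
              (|α p| + |β p|) * ε := by
            calc |β p * (Real.cos (ω p * a) - MvPolynomial.eval x (Cr p)) - α p * (Real.sin (ω p * a) - MvPolynomial.eval x (Ci p))|
                ≤ |β p * (Real.cos (ω p * a) - MvPolynomial.eval x (Cr p))| + |α p * (Real.sin (ω p * a) - MvPolynomial.eval x (Ci p))| :=
                  abs_sub _ _
              _ ≤ |β p| * ε + |α p| * ε := by
                  rw [abs_mul, abs_mul]
                  exact add_le_add (mul_le_mul_of_nonneg_left (hcos p) (abs_nonneg _))
                    (mul_le_mul_of_nonneg_left (hsin p) (abs_nonneg _))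
              _ = (|α p| + |β p|) * ε := by ring
          calc ω p * |β p * (Real.cos (ω p * a) - MvPolynomial.eval x (Cr p)) - α p * (Real.sin (ω p * a) - MvPolynomial.eval x (Ci p))|
              ≤ Ω * ((|α p| + |β p|) * ε) := mul_le_mul (hωΩ p hp) h1 (abs_nonneg _) hΩ
            _ = (|α p| + |β p|) * ε * Ω := by ring
      _ = (∑ p ∈ P₀, (|α p| + |β p|)) * ε * Ω := by rw [Finset.sum_mul, Finset.sum_mul]
      _ ≤ W * ε * Ω := mul_le_mul_of_nonneg_right (mul_le_mul_of_nonneg_right hW hε0) hΩ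
      _ = ε * W * Ω := by ring
  -- assemble
  have hev : MvPolynomial.eval x (G₀ + G₁ * (AN - A)) = MvPolynomial.eval x G₀ + MvPolynomial.eval x G₁ * (aN - a) := by
    rw [map_add, map_mul, map_sub]
  rw [hev]
  have hsplit : (g s - c) - (MvPolynomial.eval x G₀ + MvPolynomial.eval x G₁ * (aN - a)) =
      (g s - g a - g₁ a * (s - a)) + g₁ a * (s - aN) + ((g a - c) - MvPolynomial.eval x G₀) +
        (g₁ a - MvPolynomial.eval x G₁) * (aN - a) := by ring
  rw [hsplit]
  have hT1 : |g s - g a - g₁ a * (s - a)| ≤ B₂ * (d * π / 2 ^ J) ^ 2 := by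
    refine (hC11 s a).trans (mul_le_mul_of_nonneg_left ?_ hB₂0)
    rw [← sq_abs]
    exact pow_le_pow_left₀ (abs_nonneg _) hsa 2
  have hT2 : |g₁ a * (s - aN)| ≤ B₁ * (d * π / N) := by
    rw [abs_mul]; exact mul_le_mul (hB₁ a) hsaN (abs_nonneg _) hB₁0
  have hT4 : |(g₁ a - MvPolynomial.eval x G₁) * (aN - a)| ≤ ε * W * Ω * (d * π / 2 ^ J + d * π / N) := by
    rw [abs_mul]
    exact mul_le_mul hE₁ haNa (abs_nonneg _) ((abs_nonneg _).trans hE₁)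
  calc |(g s - g a - g₁ a * (s - a)) + g₁ a * (s - aN) + ((g a - c) - MvPolynomial.eval x G₀) +
        (g₁ a - MvPolynomial.eval x G₁) * (aN - a)|
      ≤ |g s - g a - g₁ a * (s - a)| + |g₁ a * (s - aN)| + |(g a - c) - MvPolynomial.eval x G₀| +
        |(g₁ a - MvPolynomial.eval x G₁) * (aN - a)| := by
        refine (abs_add_le _ _).trans (add_le_add ((abs_add_le _ _).trans (add_le_add (abs_add_le _ _) le_rfl)) le_rfl)
    _ ≤ B₂ * (d * π / 2 ^ J) ^ 2 + B₁ * (d * π / N) + ε * W + ε * W * Ω * (d * π / 2 ^ J + d * π / N) :=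
        add_le_add (add_le_add (add_le_add hT1 hT2) hE₀) hT4
    _ = B₂ * (d * π / 2 ^ J) ^ 2 + B₁ * (d * π / N) + ε * W * (1 + Ω * (d * π / 2 ^ J + d * π / N)) := by ring

end Summit.QuantumFields.YangMills.Theorems.BalabanUVNodesN19AdditiveLinksMomentFirstOrder

end
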